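import Summits.BirchSwinnertonDyer.Rank1Residual.X11b.RungK2Leaves
import HarnessLib

/-!
# Route `ErratumRoadFive` (rung K2a, `p ≥ 5`): the end-state kernel RE-KEYED on the CONSUMED upper bound —
# the Shimura-displays binder `hSh` replaced by the Euler-system half it produces
# (kernel sibling for the planner's SHIM cash-in; cell `bsd-stepL`, seat `bsd-stepL-shim-p1` g2)

`--supports stmt-BirchSwinnertonDyer-19063` (crux `ShimuraDisplays`), as a HELPER: no route decl is closed here.
The `p ≥ 5` twin of `Theorems/ClassRecordThreeKernelUpper.lean` (K2@3).

## What this file does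

The route's deciding theorem `Theses.ErratumRoadFive.closes` re-plumbs the kernel glue
`X11b.multiplicativeRankOne_of_endState` (`X11b/RungK2Leaves.lean` §2 = `P2.bsdp_of_onTree_endState`,
`X11b/BDPRouteEndState.lean`), which consumes crux 3 `ShimuraDisplays = ∀ (E,p) ∈ X11b, p ≥ 5 →
X11b.P2ShimuraDisplaysAt W p` (binder `hSh`) at ONE place: the Euler-system half `Typed.MissingUpperBoundAt W p`
on the Tamagawa sub-atom (ram) ∧ ¬(split at `p` ∧ `p ∣ ord_p Δ_min`)
(`missingUpperBoundAt_of_classX11b_of_ram_of_not_alpha_displays`, `X11b/BDPRouteRecordDelta.lean`). That half is a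
THEOREM from published named facts (`missingUpperBoundAt_of_classX11b_of_ram_of_not_alpha_pub`,
`Theorems/ErratumRoadFiveShimuraUpperHalf.lean`, p420149: Jacquet–Langlands + Pasten 2024 §6 + Cai–Shu–Tian 2014
Thm. 1.5 / JSW 2017 Thm. 4.4.1; twin `…_pub_JSW` over the typer's renderings, p425454), whereas the displays AS
STATED also ask instances at inert sets `S ∋ p` that are not in print. The seat's PART 2
(`Theorems/ErratumRoadFiveShimuraDisplays.lean`, `erratumRoadFive_multiplicativeRankOne_of_upperHalf`, p420278)
proved the re-keyed glue already — but in a module that IMPORTS the route file (its hypotheses are the route's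
decls), so the route's `closes` cannot cite it. This file states the same re-keyed glue over the KERNEL's binder
list, importing no `Theses` file, so that a route file may import it:

* `multiplicativeRankOne_of_endState_upper` — `X11b.multiplicativeRankOne_of_endState` with
  `hSh : ∀ W p, ClassX11b W p → 5 ≤ p → P2ShimuraDisplaysAt W p` REPLACED by
  `hUβ : ∀ W p, ClassX11b W p → 5 ≤ p → Ram W p → ¬(split at p ∧ p ∣ ord_p Δ_min) → Typed.MissingUpperBoundAt W p`
  (the published binder `hFH`, Friedberg–Hoffstein's inert form, used only to consume `hSh`, drops out); proof
  = PART 2's pointwise case split over the records of `X11b/BDPRouteEndState.lean` §2, verbatim.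

The re-glued `closes` of the SHIM cash-in (crux `ShimuraDisplays` → by-name support item `ShimuraCurveInputs :=
nonempty_shimuraParametrizationData ∧ PastenShimura2024_ribetTakahashiPackage ∧
shimuraCurve_heegnerPoint_grossZagier_kolyvagin`) is this theorem with
`hUβ := missingUpperBoundAt_of_classX11b_of_ram_of_not_alpha_pub hSk hGZK hmod hnf hFH hMaz hJL hRT hHK` (companion
file `ErratumRoadFiveShimuraCashIn.lean`); the restatement option (item 19063 := `ShimuraUpperHalf`, binder `h₃'`
of PART 2) is this theorem applied to the items directly.

HONEST FRAMING: THEOREMS ONLY (no definition, no named fact, no `sorry`); no new mathematics — kernel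
re-plumbing; CONDITIONAL on every binder (the cruxes are OPEN); nothing booked; X11b stays CONSTRUCTION-SHAPED;
BSD is not proved by any of this; the conclusion is the registered rung leaf `X11b.MultiplicativeRankOne`, never
the summit Statement.

References: those of `BDPRouteEndState.lean` — [JetchevSkinnerWan2017] §7.4.1–7.4.3, Thm. 4.4.1; [Castella2018]
Thm. 2.3, Thm. 3.2; [Castella2018Erratum] (2.4); [BalakrishnanEtAl2019] Thm. 1.2; [Skinner2016PacificMC] Thm. C;
[Wuthrich2014] Prop. 21; [McCallumLMS1991] §1; [Mazur1978] Cor. 4.1; [Miller2011LMS] Def. 1.1.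
-/

noncomputable section

open scoped Classical

open WeierstrassCurve NumberField IsDedekindDomain Literature.NumberTheory.EllipticCurves
  Rat.HeightOneSpectrum
  Literature.NumberTheory.EllipticCurves.ModularForms
  Literature.NumberTheory.EllipticCurves.Rank1Residual
  Literature.NumberTheory.EllipticCurves.Rank1Residual.Typed
  Literature.NumberTheory.EllipticCurves.Wuthrich2014
  Literature.NumberTheory.EllipticCurves.BalakrishnanEtAl2019
  Literature.NumberTheory.GaloisRepresentations Literature.NumberTheory.GaloisCohomology
  Summit.BirchSwinnertonDyer.Rank1Residual
  Summit.BirchSwinnertonDyer.Rank1Residual.X11b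

-- the cell's Theorems namespace repeats the summit name (Summit.<Summit>.<Problem>), as in every sibling file
set_option linter.dupNamespace false

namespace Summit.BirchSwinnertonDyer.BirchSwinnertonDyer.Theorems

/-- **K2a leaf from the end state, the displays binder replaced by the CONSUMED upper bound.**
`X11b.multiplicativeRankOne_of_endState` (`RungK2Leaves.lean` §2 = `P2.bsdp_of_onTree_endState`) with its binder
`hSh : ∀ W p, ClassX11b W p → 5 ≤ p → P2ShimuraDisplaysAt W p` REPLACED by the Euler-system half the kernel
consumed it for, `hUβ : ∀ W p, ClassX11b W p → 5 ≤ p → Ram W p → ¬(split at p ∧ p ∣ ord_p Δ_min) →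
Typed.MissingUpperBoundAt W p` — a theorem from published named facts
(`missingUpperBoundAt_of_classX11b_of_ram_of_not_alpha_pub`, p420149; `…_pub_JSW`, p425454) — and the published
binder `hFH` (used only to consume `hSh`) dropped; every other binder VERBATIM (fourteen published facts, THE open
input `hA`, (T2α′) `hUα`, (T3) `hX11a`, (T4′) `hCorner`). Proof, pointwise over the records of
`X11b/BDPRouteEndState.lean` §2 (as PART 2's `erratumRoadFive_multiplicativeRankOne_of_upperHalf`): ¬Surj → the
localised corner (`ClassX11b.not_surj_shape`, BDMTV) is `hCorner`; Surj ∧ `p ∤ ∏c` → the Locus record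
(`P2.bsdp_of_locus_endState`) or the ¬(ram) record with `hX11a` on the twist (`P2.bsdp_of_not_ram_endState`);
Surj ∧ `p ∣ ∏c` → `P2.bsdp_of_surj_of_missingUpperBoundAt_endState` with the upper half from `hUα` (¬(ram) or
(T2α)) or from `hUβ` ((ram) ∧ ¬(T2α)). No new mathematics. CONDITIONAL on every binder; nothing booked;
concludes the registered rung leaf, not the summit.
-- adapted from Summits/BirchSwinnertonDyer/BirchSwinnertonDyer/Theorems/ErratumRoadFiveShimuraDisplays.lean
[cite: JetchevSkinnerWan2017, §7.4.1–7.4.3 (pp. 30–31), Thm. 4.4.1 (p. 19)]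
[cite: Castella2018, Thm. 2.3 (p. 5), Thm. 3.2 (p. 9)] [cite: Castella2018Erratum, (2.4) (p. 1)]
[cite: BalakrishnanEtAl2019, §1 Thm. 1.2 (arXiv:1711.05846 p. 2)] [cite: Miller2011LMS, Def. 1.1] -/
theorem multiplicativeRankOne_of_endState_upper
    -- published inputs (named facts of the tree) — route SUPPORT items (NO `hFH`)
    (hGZ : ∀ (N : ℕ) [NeZero N] (W : WeierstrassCurve ℚ) (K : Type) [Field K] [NumberField K],
      gross_zagier N W K)
    (hKo : ∀ (N : ℕ) [NeZero N] (W : WeierstrassCurve ℚ) (K : Type) [Field K] [NumberField K],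
      kolyvagin N W K)
    (hB : ∀ (N : ℕ) [NeZero N] (W : WeierstrassCurve ℚ) (K : Type) [Field K] [NumberField K],
      Kolyvagin1990_padicValNat_card_sha_le N W K)
    (hSk : Skinner2016.thmC_padicValRat_bsd_rank_zero) (hWu : sha_dvd_analyticSha)
    (hGZK : rank_eq_analyticRank_of_analyticRank_le_one) (hmod : hasEntireLFunction_rat)
    (hnf : exists_isNewformOf) (hHL : HoffsteinLuo1997_exists_twist_L_one_ne_zero)
    (hFHs : friedbergHoffstein_exists_heegnerField_split_twist_ne_zero)
    (hMaz : mazur_not_dvd_maninConstant_of_odd)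
    (hBDMTV : thm12_not_le_normalizer_splitCartan)
    (hPT : ∀ (K : Type) [Field K] [NumberField K], poitouTate_sum_localTatePairing_eq_zero K)
    (hEP : ∀ (K : Type) [Field K] [NumberField K] (v : HeightOneSpectrum (𝓞 K)),
      localEulerPoincareCharacteristic (v.adicCompletion K))
    -- CRUX 1 (T1ᵗ-IMC) THE open input, at every pair
    (hA : ∀ (W : WeierstrassCurve ℚ) [W.IsElliptic] [W.IsGloballyMinimal] (p : ℕ) [Fact p.Prime],
      P2OpenInputOnTreeAt W p)
    -- CRUX 2 (T2α′) the Euler-system half off the Locus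
    (hUα : ∀ (W : WeierstrassCurve ℚ) [W.IsElliptic] [W.IsGloballyMinimal] (p : ℕ) [Fact p.Prime],
      ClassX11b W p → 5 ≤ p → p ∣ W.tamagawaProduct →
      (¬ Ram W p ∨ (W.HasSplitMultiplicativeReductionAtPrime p ∧
        p ∣ padicValInt p W.minimalDiscriminantInt)) → Typed.MissingUpperBoundAt W p)
    -- in place of CRUX 3 (T2♯-ℝ): the CONSUMED Euler-system half on (ram) ∧ ¬(T2α)
    (hUβ : ∀ (W : WeierstrassCurve ℚ) [W.IsElliptic] [W.IsGloballyMinimal] (p : ℕ) [Fact p.Prime],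
      ClassX11b W p → 5 ≤ p → Ram W p →
      ¬ (W.HasSplitMultiplicativeReductionAtPrime p ∧ p ∣ padicValInt p W.minimalDiscriminantInt) →
      Typed.MissingUpperBoundAt W p)
    -- CRUX 4 (T3) the main-conjecture half on the rank-0 sister class X11a
    (hX11a : ∀ (Wd : WeierstrassCurve ℚ) [Wd.IsElliptic] [Wd.IsGloballyMinimal] (p : ℕ)
      [Fact p.Prime], ClassX11a Wd p → Typed.MissingLowerBoundAt Wd p)
    -- CRUX 5 (T4′) the localised non-surjective corner
    (hCorner : ∀ (W : WeierstrassCurve ℚ) [W.IsElliptic] [W.IsGloballyMinimal] (p : ℕ)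
      [Fact p.Prime], ClassX11b W p → ¬ Surj W p → (p = 5 ∨ p = 7) →
        p ∣ padicValInt p W.minimalDiscriminantInt → ¬ Ram W p → Typed.MissingPPartAt W p) :
    MultiplicativeRankOne := by
  intro W _ _ p _ hX hp5
  by_cases hsurj : Surj W p
  · by_cases htam : p ∣ W.tamagawaProduct
    · -- `p ∣ ∏c`: the Euler-system half is `hUα` off (ram) ∧ ¬(T2α), and `hUβ` on it
      have hU : Typed.MissingUpperBoundAt W p := by
        by_cases hram : Ram W p
        · by_cases hα : W.HasSplitMultiplicativeReductionAtPrime p ∧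
              p ∣ padicValInt p W.minimalDiscriminantInt
          · exact hUα W p hX hp5 htam (Or.inr hα)
          · exact hUβ W p hX hp5 hram hα
        · exact hUα W p hX hp5 htam (Or.inl hram)
      exact P2.bsdp_of_surj_of_missingUpperBoundAt_endState W p hGZ hKo hWu hGZK hmod hnf hHL hMaz hPT
        hEP (hA W p) hU hX hp5 hsurj
    · by_cases hram : Ram W p
      · exact P2.bsdp_of_locus_endState W p hGZ hKo hB hSk hWu hGZK hmod hnf hHL hMaz hPT hEP (hA W p) hX
          hp5 hram htam
      · exact P2.bsdp_of_not_ram_endState W p hGZ hKo hB hWu hGZK hmod hnf hHL hFHs hMaz hPT hEP (hA W p)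
          (fun Wd _ _ hXd ↦ hX11a Wd p hXd) hX hp5 hram hsurj htam
  · -- the non-surjective corner: `p ∈ {5,7}`, `p ∣ ord_p Δ_min`, no (ram) prime (BDMTV)
    obtain ⟨h57, hdvd, hnram⟩ := ClassX11b.not_surj_shape W p hBDMTV hX hp5 hsurj
    exact Typed.bsdp_of_missingPPartAt W p hGZK (by rw [hX.1]) (hCorner W p hX hsurj h57 hdvd hnram)

end Summit.BirchSwinnertonDyer.BirchSwinnertonDyer.Theorems

end
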